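/-
Copyright (c) 2026 the pub-hodgecm-mathlib formalisation cell (harness21).  Prover seat hodgecm-mathlib-B-p04 (g47): LH4-plan (g6) price list (P1a-β) — the WILD
unit-discriminant twin of ★ (D2-β) `TypeTwoEigenFieldPackage`; 2026-09-02.
-/
import Literature.NumberTheory.NumberFields.RamifiedQuadraticDictionary     -- ★ [T2-L] (L3) `exists_mul_map_eq_of_ramified`; brings ★ (Q5) `valued_toPlace_of_ramificationIdx'_eq_two`, `valued_toPlace_add_toPlace_mul_of_ramified`
import Literature.NumberTheory.Rogawski1990.TypeTwoEigenvalueWild          -- ★ p851716 (this seat): `eigenvalue_clauses_of_skew_sqrt`, `v_eigenvalue_sub_map_of_skew_unit`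
import HarnessLib

/-!
# T3′ P-2 row (R2²), organ (D2-β)′ «THE EIGEN-FIELD PACKAGE AT w» at a WILD UNIT-DISCRIMINANT row, FROM THE FRAME DATA: given `α = √(1 + w₀)` with its Eisenstein
# coordinates and the involutions `s̃ ∕ ι′` (★ (L1u)(L2u)), derive the isometries, `Fix ι′ = ι₁F_v`, the eigenvalue `λ₁ = (t + yα)∕2` clauses and (rE)(nK)(nE) — no `|2| = 1`

Topic `NumberTheory/Rogawski1990`; namespace `Literature.NumberTheory.Rogawski1990`.  THEOREMS ONLY (no definition, no instance, no notation, no named fact, no `sorry`); kernel lane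
`--supports stmt-HodgeConjecture-24833`.  Cell `pub/hodgecm-mathlib` (D-0151), crux H413 = `stmt-HodgeConjecture-24833`; half A line LH4, the M4 wall of census F0P3a-p06 (g17)
`DUNR-H2-CENSUS`; LH4-plan (g6) WORD #40 price list **(P1a) = memo `MEMO-M4-wild-parity.v1.B-p04g47.md` §4 (c), LOCAL half**, part β (the substitution), after part α ★
`TypeTwoEigenvalueWild` and B-p08 (g40)'s wild dictionary ★ `RamifiedQuadraticDictionaryWild` ((P1b)).  A TWIN of ★ (D2-β) `TypeTwoEigenFieldPackage.exists_eigenField_package`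
(F0P2-p06 (g11)) with: the anti-fixed UNIFORMISER `θ = √d` (`|d| = exp(−1)`) replaced by the skew UNIT `α = √d`, `d = 1 + w₀`, `|w₀| = exp(−(2k+1))`, `|4| < |w₀|`; the Eisenstein
coordinates `(1, θ)` by `(1, P)`, `P := (α − 1)∕ι₁ϖ^k` (★ `WildQuadraticEisensteinFrame`); the binders `h2 : |2|_v = 1` DELETED and `hχ1 : |1 − t + D|_v < 1` (residual unipotence,
★ `v_charpoly_one_lt_one`) and `hsϖ : s ϖ = ϖ` (the `s`-fixed base uniformiser) ADDED; and the ONE changed clause `|λ₁ − ι′λ₁| = exp(−2N)` (EVEN; ★'s `exp(−(2N+1))`) — the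
«`L` even» of memo §1.  Everything else is the same token list, so the consumers of ★ (D2-β) ((D3)∕(D4) `TypeTwoUnitIndexAtPlace`, B-p14's frame half) read this package by
substitution.  HONEST LABEL: HC_CM is proved only modulo the 7 printed citations (2 remaining named inputs: hLiu418 = stmt-HodgeConjecture-24832, h413 = stmt-HodgeConjecture-24833)
until rung 0 closes; count-neutral (pays no organ, opens no road — with ★ `RationalGoodVectorParityUniform` it is the second of the memo's two Lean bricks for M4's (c)).

WHY «FROM THE FRAME DATA» (β₁): the frame outputs of ★ p851701 (L1u) `exists_sqrt_and_coord_of_wildUnit` (`α`, `|α| = 1`, `|P| = exp(−1)`, unique coordinates on `(1, P)`,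
integrality) and (L2u) `exists_involutions_of_wildUnit` (`s̃`, `ι′` with their four properties each) enter here as BINDERS, so this file elaborates on the served oleans today;
the 12-line instantiation `exists_eigenField_package_wildUnit` (β₂: two `obtain`s + this theorem) is the sequel once ★ p851701's olean is served to the check farm (at writing
time every file importing it answered «farm unavailable», rc 75).

THE PACKAGE (`eigenField_package_wildUnit_of_frame`):
* `α` — (L1u): `α² = ι₁ d`, `|α| = 1`, `|P| = exp(−1)` for `P = (α − 1)∕ι₁ϖ^k`, unique coordinates `z = ι₁ p + ι₁ q·P`, `ι₁ p + ι₁ q·P ∈ 𝒪 ↔ p, q ∈ 𝒪`;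
* `s̃` — (L2u) + isometry: `s̃ ∘ ι₁ = ι₁ ∘ s`, `s̃ α = α`, `s̃ s̃ = id`, `s̃ 𝒪 ⊆ 𝒪`, `|s̃ z| = |z|`;  `ι′` — `ι′ ∘ ι₁ = ι₁`, `ι′ α = −α`, `ι′ ι′ = id`, `ι′ 𝒪 ⊆ 𝒪`, `|ι′ z| = |z|`, `s̃ι′ = ι′s̃`
  (the isometry of `ι′` through `ι′P = −P − ι₁(2∕ϖ^k)`, `|2∕ϖ^k|_v ≤ exp(−1)` ★ `valued_two_mul_exp_le_of_valued_four_lt`);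
* `λ₁ := (ι₁ t + ι₁ y·α)·ι₁ e₂`: `λ₁² − ι₁t·λ₁ + ι₁D = 0`, `λ₁ ∈ 𝒪`, `|λ₁ − 1| < 1` (ROOT ARGUMENTS, ★ part α), `λ₁·s̃λ₁ = 1`, `ι′λ₁ = (ι₁t − ι₁y·α)·ι₁e₂ ≠ λ₁`, `|ι₁u − λ₁| = exp(−n)`,
  **`|λ₁ − ι′λ₁| = exp(−2N)`**;
* (rE) `ι′x = x ⇒ Even (log|x|)`, (nK) `s̃c = c ⇒ Even (log|c|) ⇒ ∃ a, a·s̃a·c = 1` (normalise by `P^{2k'}`, `s̃P = P`; ★ (L3)), (nE) from `hnormF` — verbatim ★'s.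

## References
* [Rogawski1990] J. D. Rogawski, *Automorphic Representations of Unitary Groups in Three Variables* (1990): §4.9 Lemma 4.9.3 p. 56, Prop. 4.9.1 (b) p. 55.
* [SerreLocalFields1979] J.-P. Serre, *Local Fields*, GTM 67 (1979): Ch. I §6 Prop. 17–18; Ch. V §2 Prop. 3 and Corollary.
* [Jacobowitz1962] R. Jacobowitz, *Hermitian forms over local fields*, Amer. J. Math. 84 (1962): §5, §7, §§9–11 (ramified dyadic «R-U»).
* [Omeara1963] O. T. O'Meara, *Introduction to Quadratic Forms* (1963): §63A 63:2–63:3.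
-/

set_option autoImplicit false

noncomputable section

open NumberField IsDedekindDomain Polynomial WithZero
open scoped ValuativeRel
open Literature.NumberTheory.Automorphic Literature.NumberTheory.Automorphic.UnitaryGroup Literature.NumberTheory.NumberFields

namespace Literature.NumberTheory.Rogawski1990

variable {F : Type} (E : Type) [Field F] [NumberField F] [Field E] [NumberField E] [Algebra F E]
  (v : HeightOneSpectrum (𝓞 F)) {d w₀ : v.adicCompletion F} (hdw : d = 1 + w₀) {k : ℕ} (hw₀ : Valued.v w₀ = exp (-(2 * (k : ℤ) + 1)))
  (h4 : Valued.v (4 : v.adicCompletion F) < Valued.v w₀)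
  {ϖ : v.adicCompletion F} (hϖ : Valued.v ϖ = exp (-1 : ℤ)) (w : PlacesOver E v) (he : v.asIdeal.ramificationIdx' w.1.asIdeal = 2)
  -- the frame data of ★ (L1u): `α = √d`, the Eisenstein uniformiser `P = (α − 1)∕ι₁ϖ^k`, unique coordinates and integrality on `(1, P)`
  {α : w.1.adicCompletion E} (hα : α ^ 2 = toPlace v w d) (hαv : Valued.v α = 1) (hPv : Valued.v ((α - 1) / toPlace v w ϖ ^ k) = exp (-1 : ℤ))
  (hcoord : ∀ z : w.1.adicCompletion E, ∃! pq : v.adicCompletion F × v.adicCompletion F, z = toPlace v w pq.1 + toPlace v w pq.2 * ((α - 1) / toPlace v w ϖ ^ k))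
  (hint : ∀ p q : v.adicCompletion F, toPlace v w p + toPlace v w q * ((α - 1) / toPlace v w ϖ ^ k) ∈ 𝒪[w.1.adicCompletion E] ↔
    p ∈ 𝒪[v.adicCompletion F] ∧ q ∈ 𝒪[v.adicCompletion F])
  -- the isometric involution `s` of `F_v` fixing `d` and `ϖ` (CM conjugation `σ_w` of `L_w` in the application), moving an integer by a unit, with the even-order norm dictionary
  (s : v.adicCompletion F →+* v.adicCompletion F) (hsϖ : s ϖ = ϖ) (hsv : ∀ x, Valued.v (s x) = Valued.v x)
  (hmove : ∃ a : 𝒪[v.adicCompletion F], IsUnit a ∧ s a - a ∈ 𝒪[v.adicCompletion F] ∧ ∃ b : 𝒪[v.adicCompletion F], (b : v.adicCompletion F) * (s a - a) = 1)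
  (hnormF : ∀ c : v.adicCompletion F, c ≠ 0 → s c = c → Even (log (Valued.v c)) → ∃ a : v.adicCompletion F, a * s a * c = 1)
  -- the type-(2) eigen-data of a deep match (★ (D1)): `χ_g = X² − tX + D`, `disc χ_g = y² d`, the norm-one eigenvalue `u`, `e₂ = 1∕2`; NO `|2| = 1`
  (u t D y e₂ : v.adicCompletion F) (h2e : e₂ * 2 = 1) (hD : 4 * D = t * t - y * y * d)
  (hσD : D * s D = 1) (hσt : s t = t * s D) (hσy : s y = -(y * s D))
  {n N : ℕ} (hn : Valued.v (u * u - t * u + D) = exp (-(n : ℤ))) (hN : Valued.v y = exp (-(N : ℤ)))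
  (ht2 : Valued.v (t - 2) < 1) (hχ1 : Valued.v (1 - t + D) < 1)
  -- the frame data of ★ (L2u): the involutions `s̃` over `s` fixing `α`, and `ι′` over `id` with `ι′ α = −α`
  (s' ι' : w.1.adicCompletion E →+* w.1.adicCompletion E)
  (hs'ι : ∀ x, s' (toPlace v w x) = toPlace v w (s x)) (hs'α : s' α = α) (hs's' : ∀ z, s' (s' z) = z) (hs'O : ∀ z : 𝒪[w.1.adicCompletion E], s' z ∈ 𝒪[w.1.adicCompletion E])
  (hι'ι : ∀ x, ι' (toPlace v w x) = toPlace v w x) (hι'α : ι' α = -α) (hι'ι' : ∀ z, ι' (ι' z) = z) (hι'O : ∀ z : 𝒪[w.1.adicCompletion E], ι' z ∈ 𝒪[w.1.adicCompletion E])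

include hdw hw₀ h4 hϖ he hα hαv hPv hcoord hint hsϖ hsv hmove hnormF h2e hD hσD hσt hσy hn hN ht2 hχ1 hs'ι hs'α hs's' hs'O hι'ι hι'α hι'ι' hι'O in
/-- **(D2-β)′ THE EIGEN-FIELD PACKAGE AT `w`, WILD UNIT-DISCRIMINANT ROW, FROM THE FRAME DATA** (see the module docstring for the clause list; token-parallel to ★
`exists_eigenField_package` with `θ ↦ α`, `(1, θ) ↦ (1, (α − 1)∕ι₁ϖ^k)`, `exp(−(2N+1)) ↦ exp(−2N)`, and no `|2| = 1`; the frame outputs of ★ (L1u)(L2u) are binders).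
[cite: Rogawski1990, §4.9 Lemma 4.9.3 p. 56] [cite: SerreLocalFields1979, Ch. I §6 Prop. 17–18; Ch. V §2 Prop. 3] [cite: Jacobowitz1962, §§9–11] [cite: Omeara1963, §63A 63:2–63:3] -/
theorem eigenField_package_wildUnit_of_frame :
      -- (L1u) `α = √d` and the Eisenstein coordinates on `(1, P)` (returned for the consumer's convenience)
      (α ^ 2 = toPlace v w d ∧ Valued.v α = 1 ∧ Valued.v ((α - 1) / toPlace v w ϖ ^ k) = exp (-1 : ℤ) ∧
        (∀ z : w.1.adicCompletion E, ∃! pq : v.adicCompletion F × v.adicCompletion F, z = toPlace v w pq.1 + toPlace v w pq.2 * ((α - 1) / toPlace v w ϖ ^ k)) ∧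
        (∀ p q : v.adicCompletion F, toPlace v w p + toPlace v w q * ((α - 1) / toPlace v w ϖ ^ k) ∈ 𝒪[w.1.adicCompletion E] ↔
          p ∈ 𝒪[v.adicCompletion F] ∧ q ∈ 𝒪[v.adicCompletion F])) ∧
      -- (L2u) the involution `s̃` over `s` fixing `α`, isometric
      ((∀ x, s' (toPlace v w x) = toPlace v w (s x)) ∧ s' α = α ∧ (∀ z, s' (s' z) = z) ∧
        (∀ z : 𝒪[w.1.adicCompletion E], s' z ∈ 𝒪[w.1.adicCompletion E]) ∧ (∀ z, Valued.v (s' z) = Valued.v z)) ∧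
      -- (L2u) the `F_v`-linear involution `ι′` with `ι′ α = −α`, isometric, commuting with `s̃`
      ((∀ x, ι' (toPlace v w x) = toPlace v w x) ∧ ι' α = -α ∧ (∀ z, ι' (ι' z) = z) ∧
        (∀ z : 𝒪[w.1.adicCompletion E], ι' z ∈ 𝒪[w.1.adicCompletion E]) ∧ (∀ z, Valued.v (ι' z) = Valued.v z) ∧ (∀ z, s' (ι' z) = ι' (s' z))) ∧
      -- the eigenvalue `λ₁ := (ι₁ t + ι₁ y · α) · ι₁ e₂`
      (((toPlace v w t + toPlace v w y * α) * toPlace v w e₂) ^ 2 - toPlace v w t * ((toPlace v w t + toPlace v w y * α) * toPlace v w e₂) + toPlace v w D = 0 ∧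
        (toPlace v w t + toPlace v w y * α) * toPlace v w e₂ ∈ 𝒪[w.1.adicCompletion E] ∧
        Valued.v ((toPlace v w t + toPlace v w y * α) * toPlace v w e₂ - 1) < 1 ∧
        (toPlace v w t + toPlace v w y * α) * toPlace v w e₂ * s' ((toPlace v w t + toPlace v w y * α) * toPlace v w e₂) = 1 ∧
        ι' ((toPlace v w t + toPlace v w y * α) * toPlace v w e₂) = (toPlace v w t - toPlace v w y * α) * toPlace v w e₂ ∧
        ι' ((toPlace v w t + toPlace v w y * α) * toPlace v w e₂) ≠ (toPlace v w t + toPlace v w y * α) * toPlace v w e₂ ∧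
        Valued.v (toPlace v w u - (toPlace v w t + toPlace v w y * α) * toPlace v w e₂) = exp (-(n : ℤ)) ∧
        Valued.v ((toPlace v w t + toPlace v w y * α) * toPlace v w e₂ - ι' ((toPlace v w t + toPlace v w y * α) * toPlace v w e₂)) = exp (-(2 * (N : ℤ)))) ∧
      -- the three norm dictionaries (rE) (nK) (nE) of ★ `exists_rational_good_iff_even(_uniform)`, in its binder spelling
      ((∀ x : w.1.adicCompletion E, x ≠ 0 → ι' x = x → Even (log (Valued.v x))) ∧
        (∀ c : w.1.adicCompletion E, c ≠ 0 → s' c = c → Even (log (Valued.v c)) → ∃ a : w.1.adicCompletion E, a * s' a * c = 1) ∧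
        (∀ c : w.1.adicCompletion E, c ≠ 0 → s' c = c → ι' c = c → (4 : ℤ) ∣ log (Valued.v c) →
          ∃ a : w.1.adicCompletion E, ι' a = a ∧ a * s' a * c = 1)) := by
  have hι : Function.Injective (toPlace v w) := (toPlace v w).injective
  have h20 : (2 : v.adicCompletion F) ≠ 0 := by
    rw [show (2 : v.adicCompletion F) = algebraMap F (v.adicCompletion F) 2 by rw [map_ofNat]]
    exact (_root_.map_ne_zero (algebraMap F (v.adicCompletion F))).2 two_ne_zero
  have hw₀1 : Valued.v w₀ < 1 := by rw [hw₀, ← exp_zero, exp_lt_exp]; omega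
  have hϖ0 : ϖ ≠ 0 := (Valuation.ne_zero_iff _).1 (by rw [hϖ]; exact exp_ne_zero)
  -- `s 𝒪 ⊆ 𝒪` from the isometry
  have hsO : ∀ x : 𝒪[v.adicCompletion F], s x ∈ 𝒪[v.adicCompletion F] := fun x => by
    rw [mem_integer_iff_valued_le_one, hsv]; exact (mem_integer_iff_valued_le_one _).1 x.2
  have _ := hsO
  set P : w.1.adicCompletion E := (α - 1) / toPlace v w ϖ ^ k with hPdef
  have hα0 : α ≠ 0 := fun h0 => by rw [h0, map_zero] at hαv; exact zero_ne_one hαv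
  have hP0 : P ≠ 0 := fun h0 => by rw [h0, map_zero] at hPv; exact WithZero.coe_ne_zero hPv.symm
  -- the constant `c := 2 ∕ ϖ^k` of `ι′P = −P − ι₁ c`, `|c| ≤ exp(−1)`, `s c = c`
  set c₂ : v.adicCompletion F := 2 / ϖ ^ k with hc₂def
  have hvc₂ : Valued.v c₂ ≤ exp (-1 : ℤ) := by
    -- `|4| < |w₀| = exp(−(2k+1))` gives `2·log|2| < −(2k+1)`, so `log|2| + k ≤ −1`
    have hv20 : Valued.v (2 : v.adicCompletion F) ≠ 0 := (Valuation.ne_zero_iff _).2 h20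
    have h4' := h4
    rw [show (4 : v.adicCompletion F) = 2 * 2 by norm_num, map_mul, hw₀, ← exp_log hv20, ← exp_add, exp_lt_exp] at h4'
    rw [hc₂def, map_div₀, map_pow, hϖ, ← exp_nsmul, ← exp_log hv20, ← exp_sub, exp_le_exp, nsmul_eq_mul]
    omega
  have hsc₂ : s c₂ = c₂ := by rw [hc₂def, map_div₀, map_pow, map_ofNat, hsϖ]
  have hs'P : s' P = P := by rw [hPdef, map_div₀, map_pow, map_sub, map_one, hs'α, hs'ι, hsϖ]
  have hι'P : ι' P = -P - toPlace v w c₂ := by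
    rw [hPdef, map_div₀, map_pow, map_sub, map_one, hι'α, hι'ι, hc₂def, map_div₀, map_pow, map_ofNat]
    have : toPlace v w ϖ ^ k ≠ 0 := pow_ne_zero _ ((_root_.map_ne_zero _).2 hϖ0)
    field_simp
    ring
  -- valuations in the Eisenstein coordinates
  have hιv : ∀ p : v.adicCompletion F, Valued.v (toPlace v w p) = Valued.v p ^ 2 := valued_toPlace_of_ramificationIdx'_eq_two E v w he
  have hval : ∀ p q : v.adicCompletion F, Valued.v (toPlace v w p + toPlace v w q * P) = max (Valued.v p ^ 2) (Valued.v q ^ 2 * exp (-1 : ℤ)) :=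
    valued_toPlace_add_toPlace_mul_of_ramified E v w he hPv
  have hco : ∀ z : w.1.adicCompletion E, ∃ pq : v.adicCompletion F × v.adicCompletion F, z = toPlace v w pq.1 + toPlace v w pq.2 * P :=
    fun z => (hcoord z).exists
  have hs'pq : ∀ p q : v.adicCompletion F, s' (toPlace v w p + toPlace v w q * P) = toPlace v w (s p) + toPlace v w (s q) * P := fun p q => by
    rw [map_add, map_mul, hs'ι, hs'ι, hs'P]
  have hι'pq : ∀ p q : v.adicCompletion F, ι' (toPlace v w p + toPlace v w q * P) = toPlace v w (p - q * c₂) + toPlace v w (-q) * P := fun p q => by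
    rw [map_add, map_mul, hι'ι, hι'ι, hι'P, map_sub, map_mul, map_neg]; ring
  -- the twisted max: `max |p − q c|² (|q|² e⁻¹) = max |p|² (|q|² e⁻¹)` for `|c| ≤ exp(−1)`
  have hmax : ∀ p q : v.adicCompletion F, max (Valued.v (p - q * c₂) ^ 2) (Valued.v q ^ 2 * exp (-1 : ℤ)) = max (Valued.v p ^ 2) (Valued.v q ^ 2 * exp (-1 : ℤ)) := by
    intro p q
    rcases eq_or_ne q 0 with rfl | hq0
    · simp
    have hvq : Valued.v q ≠ 0 := (Valuation.ne_zero_iff _).2 hq0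
    have hqc : Valued.v (q * c₂) ^ 2 < Valued.v q ^ 2 * exp (-1 : ℤ) := by
      rw [map_mul, mul_pow, sq (Valued.v c₂), ← mul_assoc]
      calc Valued.v q ^ 2 * Valued.v c₂ * Valued.v c₂ ≤ Valued.v q ^ 2 * exp (-1 : ℤ) * Valued.v c₂ := mul_le_mul_left (mul_le_mul_right hvc₂ _) _
        _ < Valued.v q ^ 2 * exp (-1 : ℤ) * 1 := by
            refine mul_lt_mul_of_pos_left (hvc₂.trans_lt (by rw [← exp_zero, exp_lt_exp]; norm_num)) ?_
            exact mul_pos (pow_pos (zero_lt_iff.2 hvq) 2) exp_pos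
        _ = Valued.v q ^ 2 * exp (-1 : ℤ) := mul_one _
    by_cases hpq : Valued.v (q * c₂) < Valued.v p
    · rw [Valuation.map_sub_eq_of_lt_left _ hpq]
    · rw [not_lt] at hpq
      have hp2 : Valued.v p ^ 2 ≤ Valued.v (q * c₂) ^ 2 := pow_le_pow_left₀ zero_le hpq 2
      have hp'2 : Valued.v (p - q * c₂) ^ 2 ≤ Valued.v (q * c₂) ^ 2 :=
        pow_le_pow_left₀ zero_le ((Valuation.map_sub _ _ _).trans (max_le hpq le_rfl)) 2
      rw [max_eq_right (hp'2.trans hqc.le), max_eq_right (hp2.trans hqc.le)]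
  -- isometries and the commutation
  have hs'v : ∀ z, Valued.v (s' z) = Valued.v z := fun z => by
    obtain ⟨pq, rfl⟩ := hco z
    rw [hs'pq, hval, hval, hsv, hsv]
  have hι'v : ∀ z, Valued.v (ι' z) = Valued.v z := fun z => by
    obtain ⟨pq, rfl⟩ := hco z
    rw [hι'pq, hval, hval, Valuation.map_neg, hmax]
  have hcomm : ∀ z, s' (ι' z) = ι' (s' z) := fun z => by
    obtain ⟨pq, rfl⟩ := hco z
    rw [hι'pq, hs'pq, hs'pq, hι'pq, map_neg, map_sub, map_mul, hsc₂]
  -- `ι′`-fixed elements are `ι₁ p`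
  have hfix : ∀ x : w.1.adicCompletion E, ι' x = x → ∃ p : v.adicCompletion F, x = toPlace v w p := by
    intro x hx
    obtain ⟨pq, rfl⟩ := hco x
    rw [hι'pq] at hx
    have huniq := (hcoord (toPlace v w pq.1 + toPlace v w pq.2 * P)).unique (y₁ := (pq.1 - pq.2 * c₂, -pq.2)) (y₂ := (pq.1, pq.2)) hx.symm rfl
    have hq : pq.2 = 0 := by
      have h1 : -pq.2 = pq.2 := congrArg Prod.snd huniq
      have h2' : (2 : v.adicCompletion F) * pq.2 = 0 := by linear_combination -h1
      exact (mul_eq_zero.1 h2').resolve_left h20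
    exact ⟨pq.1, by rw [hq, map_zero, zero_mul, add_zero]⟩
  -- the eigenvalue clauses (★ part α)
  have hy0 : y ≠ 0 := fun h0 => by rw [h0, map_zero] at hN; exact WithZero.coe_ne_zero hN.symm
  obtain ⟨hquad, hlamle, hlam1, hnorm1, hι'lam, hι'ne, hvu, hdiff⟩ :=
    eigenvalue_clauses_of_skew_sqrt (toPlace v w) s s' ι' hιv hs'ι hι'ι hι'v hsv hα hα0 hs'α hι'α h2e hD hσD hσt hσy hn hy0 ht2 hχ1
  have hLeven : Valued.v ((toPlace v w t + toPlace v w y * α) * toPlace v w e₂ - ι' ((toPlace v w t + toPlace v w y * α) * toPlace v w e₂)) = exp (-(2 * (N : ℤ))) :=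
    v_eigenvalue_sub_map_of_skew_unit (toPlace v w) ι' hιv hι'ι (w₀ := w₀) (by rw [hα, hdw]) hw₀1 hι'α h2e hN
  refine ⟨⟨hα, hαv, hPv, hcoord, hint⟩, ⟨hs'ι, hs'α, hs's', hs'O, hs'v⟩, ⟨hι'ι, hι'α, hι'ι', hι'O, hι'v, hcomm⟩,
    ⟨hquad, (mem_integer_iff_valued_le_one _).2 hlamle, hlam1, hnorm1, hι'lam, hι'ne, hvu, hLeven⟩, ⟨?_, ?_, ?_⟩⟩
  · -- (rE)
    intro x hx0 hx
    obtain ⟨p, rfl⟩ := hfix x hx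
    have hp0 : Valued.v p ≠ 0 := fun h0 => hx0 (by rw [(Valuation.zero_iff _).1 h0, map_zero])
    rw [hιv, sq, log_mul hp0 hp0]
    exact ⟨_, rfl⟩
  · -- (nK): `s̃`-fixed elements of even order are norms from `K` (★ (L3)), normalised by the `s̃`-fixed uniformiser `P`
    intro c hc0 hsc ⟨k', hk'⟩
    have hvc0 : Valued.v c ≠ 0 := (Valuation.ne_zero_iff _).2 hc0
    have hu₀v : Valued.v (c * P ^ (k' + k')) = 1 := by
      rw [map_mul, map_zpow₀, hPv, ← exp_zsmul, ← exp_log hvc0, hk', ← exp_add, ← exp_zero]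
      congr 1; simp only [smul_eq_mul]; ring
    have hu₀O : c * P ^ (k' + k') ∈ 𝒪[w.1.adicCompletion E] := (mem_integer_iff_valued_le_one _).2 hu₀v.le
    have hu₀ne : c * P ^ (k' + k') ≠ 0 := mul_ne_zero hc0 (zpow_ne_zero _ hP0)
    have hu₀u : IsUnit (⟨c * P ^ (k' + k'), hu₀O⟩ : 𝒪[w.1.adicCompletion E]) := by
      have hinvO : (c * P ^ (k' + k'))⁻¹ ∈ 𝒪[w.1.adicCompletion E] := (mem_integer_iff_valued_le_one _).2 (by rw [map_inv₀, hu₀v, inv_one])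
      exact IsUnit.of_mul_eq_one ⟨_, hinvO⟩ (Subtype.ext (mul_inv_cancel₀ hu₀ne))
    have hsu₀ : s' ((⟨c * P ^ (k' + k'), hu₀O⟩ : 𝒪[w.1.adicCompletion E]) : w.1.adicCompletion E) = c * P ^ (k' + k') := by
      change s' (c * P ^ (k' + k')) = _
      rw [map_mul, map_zpow₀, hsc, hs'P]
    obtain ⟨t₀, ht₀⟩ := exists_mul_map_eq_of_ramified E v w s hmove s' hs'ι hs's' hs'O _ hu₀u hsu₀
    have ht₀' : (t₀ : w.1.adicCompletion E) * s' t₀ = c * P ^ (k' + k') := ht₀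
    have ht₀0 : (t₀ : w.1.adicCompletion E) ≠ 0 := by
      intro h0
      rw [h0, zero_mul] at ht₀'
      exact hu₀ne ht₀'.symm
    have hs't₀0 : s' (t₀ : w.1.adicCompletion E) ≠ 0 := (map_ne_zero s').2 ht₀0
    refine ⟨P ^ k' * (t₀ : w.1.adicCompletion E)⁻¹, ?_⟩
    rw [map_mul, map_inv₀, map_zpow₀, hs'P]
    field_simp
    rw [ht₀', zpow_add₀ hP0]
    ring
  · -- (nE): doubly fixed elements with `4 ∣ log` are norms of `ι′`-fixed elements (`hnormF`)
    intro c hc0 hsc hιc h4'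
    obtain ⟨p, rfl⟩ := hfix c hιc
    have hp0 : p ≠ 0 := fun h0 => hc0 (by rw [h0, map_zero])
    have hvp0 : Valued.v p ≠ 0 := (Valuation.ne_zero_iff _).2 hp0
    have hsp : s p = p := hι (by rw [← hs'ι, hsc])
    have heven : Even (log (Valued.v p)) := by
      rw [hιv, sq, log_mul hvp0 hvp0] at h4'
      obtain ⟨r, hr⟩ := h4'
      exact ⟨r, by omega⟩
    obtain ⟨a₀, ha₀⟩ := hnormF p hp0 hsp heven
    exact ⟨toPlace v w a₀, hι'ι a₀, by rw [hs'ι, ← map_mul, ← map_mul, ha₀, map_one]⟩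

end Literature.NumberTheory.Rogawski1990

end
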